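import Summits.BirchSwinnertonDyer.BirchSwinnertonDyer.Theorems.KimAtThreeDeepLowerExpStarOmegaTransport
import Literature.NumberTheory.PAdicHodge.BdROuterGalois
import Literature.NumberTheory.PAdicHodge.DualExpEllipticRestriction
import Literature.NumberTheory.EllipticCurves.TateModuleContinuityProofs
import HarnessLib

/-!
# `exp*_ω` on `H¹(F, V_pE)` is equivariant under OUTER Galois conjugation — up to the transported generator
# (route `EdixhovenFibreFiveSeven`, crux K★ `StarredOptimalManinUnitFiveSeven` stmt-BirchSwinnertonDyer-22226, line `kato-lever`, G5 by Galois descent)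

HONEST FRAMING. Theorems only (no definition, no named fact, no `sorry`, no instance); `--supports` 22226 (helper); nothing is
closed; BSD / K★ / [REC-tower] are NOT proved by this file.

Setting (`Literature/NumberTheory/GaloisRepresentations/OuterGaloisConjugation`, `PAdicHodge/BdROuterGalois`): an elliptic curve `W/K₀`,
a `p`-adic field `F ⊇ K₀`, an automorphism `g` of `F` over `K₀` with a lift `ĝ : F̄ ≃ₐ[K₀] F̄`, the outer conjugation `α : Γ_F ≃ₜ* Γ_F`
(`α σ • ĝ x = ĝ (σ • x)`), the element `τ ∈ Γ_{K₀}` with `j_F ∘ τ = ĝ ∘ j_F`, and `Conj = «pull back along α⁻¹, apply T(τ)»` on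
`Z¹(Γ_F, T_pW|_{Γ_F})`.

* §1 `cyclotomicCharacter_outerConj`, `logCyclotomic_outerConj` — `χ_cyclo(α⁻¹ σ) = χ_cyclo(σ)` (`α⁻¹ σ = ĝ⁻¹ σ ĝ` acts on a primitive
  `p^k`-th root `ζ` as `σ` acts on `ĝ ζ`).
* §2 `ratGalEquiv_intertwines_outer` — `V(τ)` intertwines `V_pW|_{Γ_F} ∘ α⁻¹` with `V_pW|_{Γ_F}`; `cupLogInjective_outerRestrict`.
* §3 ★ `exists_filZeroLine_expStarCoord_outerConj` — **there is a generator `ω''` of the line `D⁰_dR(V_pW|_{Γ_F})` — the transport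
  `(1 ⊗ V(τ))(Φ_ĝ ⊗ 1) ω` of the given generator `ω` along the filtered, `g`-semilinear automorphism `Φ_ĝ` of `B_dR(F)` over `α`
  (`BdROuterGalois.exists_fracBdR_ringEquiv_outer`) — such that `exp*_{ω''}(Conj η) = g (exp*_ω(η))` for EVERY `η ∈ Z¹(Γ_F, T_pW|_{Γ_F})`**
  (the tree's abstract transport of Kato's relation `KimAtThreeDeepLowerExpStarOmegaTransport.dualExpCoord_transport`, run for the
  `g`-semilinear `Φ_ĝ` with the coefficient-field structure `F →[g] F`, followed by `FilZeroLine.dualExpCoord_map` along `V(τ)`).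
  The identification `ω'' = ω` for a generator coming from `F₀ ⊆ F` with `g|_{F₀} = id` is the sequel file.

## References
* K. Kato, LNM 1553 (1993), Ch. II §1.2.4 (functoriality of `exp*`), Prop. 1.2.3. [Kato1993LNM1553]
* O. Brinon, B. Conrad, *CMI notes on p-adic Hodge theory* (2009), Prop. 6.3.8. [BrinonConrad2009]
* J.-P. Serre, *Galois Cohomology* (1997), I §2.4 (compatible pairs), I §5.8. [SerreGaloisCohomology1997]
-/

set_option autoImplicit false
-- the Theorems namespace of a single-conjunct summit repeats the summit name by design (D-0017)
set_option linter.dupNamespace false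

noncomputable section

open scoped TensorProduct
open Field ValuativeRel Function WittVector
open Literature.NumberTheory.GaloisRepresentations
open Literature.NumberTheory.GaloisRepresentations.PeriodRingData
open Literature.NumberTheory.PAdicHodge
open Literature.NumberTheory.EllipticCurves _root_.WeierstrassCurve
open Summit.BirchSwinnertonDyer.BirchSwinnertonDyer.Theorems.KimAtThreeDeepLowerExpStarOmegaTransport

namespace Summit.BirchSwinnertonDyer.BirchSwinnertonDyer.Theorems.StarredOptimalManinUnitFiveSevenDualExpOuterGalois

variable {K₀ : Type} [Field K₀] [CharZero K₀] (W : WeierstrassCurve K₀) [W.IsElliptic]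
  (F : Type) [Field F] [Algebra K₀ F] [ValuativeRel F] [TopologicalSpace F] [IsNonarchimedeanLocalField F] [CharZero F]
  {p : ℕ} [Fact p.Prime] [Fact (¬ IsUnit (p : integerC F))] [IsAdicComplete (Ideal.span {(p : integerC F)}) (integerC F)]
  (hp : valuation F p < 1) [Algebra ℚ_[p] F]
  (g : F ≃ₐ[K₀] F) (ĝ : AlgebraicClosure F ≃ₐ[K₀] AlgebraicClosure F)
  (hĝ : ∀ c : F, ĝ (algebraMap F (AlgebraicClosure F) c) = algebraMap F (AlgebraicClosure F) (g c))
  {α : absoluteGaloisGroup F ≃ₜ* absoluteGaloisGroup F}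
  (hα : ∀ (σ : absoluteGaloisGroup F) (x : AlgebraicClosure F), α σ • ĝ x = ĝ (σ • x))
  {τ : absoluteGaloisGroup K₀}
  (hτ : ∀ x : AlgebraicClosure K₀, absClosureEmbedding K₀ F (τ • x) = ĝ (absClosureEmbedding K₀ F x))
  (hconj : ∀ σ : absoluteGaloisGroup F,
    absGaloisRestrict K₀ F σ =
      τ * ((absGaloisRestrict K₀ F).comp (α.symm : absoluteGaloisGroup F →ₜ* absoluteGaloisGroup F)) σ * τ⁻¹)
  {gτ : W.rationalTateModule p ≃ₗ[ℚ_[p]] W.rationalTateModule p}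
  (hgτ : ∀ m, gτ m = (W.rationalTateGaloisRep p (W.continuous_rationalGaloisRepTate_holds p)) τ m)

/-! ### §1 The cyclotomic character is invariant under outer conjugation -/

omit [CharZero K₀] [ValuativeRel F] [TopologicalSpace F] [IsNonarchimedeanLocalField F]
  [Fact (¬ IsUnit (p : integerC F))] [IsAdicComplete (Ideal.span {(p : integerC F)}) (integerC F)] [Algebra ℚ_[p] F] in
include hα in
/-- **`χ_cyclo(α⁻¹ σ) = χ_cyclo(σ)`**: on a primitive `p^k`-th root of unity `ζ`, `α⁻¹ σ` acts as `ζ ↦ ĝ⁻¹(σ(ĝ ζ))`, and `ĝ ζ` is again a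
primitive `p^k`-th root of unity. [cite: SerreGaloisCohomology1997, I §2.4] -/
theorem cyclotomicCharacter_outerConj (σ : absoluteGaloisGroup F) :
    GaloisRep.cyclotomicCharacter F p (α.symm σ) = GaloisRep.cyclotomicCharacter F p σ := by
  haveI : NeZero (p : F) := ⟨Nat.cast_ne_zero.2 (Fact.out : p.Prime).ne_zero⟩
  refine Units.ext (PadicInt.ext_of_toZModPow.mp fun k => ?_)
  haveI : NeZero ((p : ℕ) : AlgebraicClosure F) := NeZero.nat_of_injective (algebraMap F (AlgebraicClosure F)).injective
  haveI : NeZero ((p ^ k : ℕ) : AlgebraicClosure F) := ⟨by rw [Nat.cast_pow]; exact pow_ne_zero _ (NeZero.ne _)⟩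
  obtain ⟨ζ, hζ⟩ := HasEnoughRootsOfUnity.exists_primitiveRoot (AlgebraicClosure F) (p ^ k)
  have hζ' : IsPrimitiveRoot (ĝ ζ) (p ^ k) := hζ.map_of_injective ĝ.injective
  have h1 := GaloisRep.cyclotomicCharacter_spec F p (k := k) (α.symm σ) ζ hζ.pow_eq_one
  have h2 := GaloisRep.cyclotomicCharacter_spec F p (k := k) σ (ĝ ζ) hζ'.pow_eq_one
  have h3 := congrArg ĝ h1
  rw [outerConj_symm_smul F ĝ hα, map_pow, h2] at h3
  have h4 := hζ'.pow_inj (ZMod.val_lt _) (ZMod.val_lt _) h3.symm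
  exact ZMod.val_injective _ h4

omit [CharZero K₀] [ValuativeRel F] [TopologicalSpace F] [IsNonarchimedeanLocalField F]
  [Fact (¬ IsUnit (p : integerC F))] [IsAdicComplete (Ideal.span {(p : integerC F)}) (integerC F)] [Algebra ℚ_[p] F] in
include hα in
/-- `log χ_cyclo(σ) = log χ_cyclo(α⁻¹ σ)` (the hypothesis `hψ` of the abstract transport for `s = α⁻¹`). [cite: Kato1993LNM1553, Ch. II §1.2.2] -/
theorem logCyclotomic_outerConj (σ : absoluteGaloisGroup F) :
    logCyclotomic p σ = logCyclotomic p ((α.symm : absoluteGaloisGroup F →ₜ* absoluteGaloisGroup F) σ) := by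
  unfold logCyclotomic
  rw [show (α.symm : absoluteGaloisGroup F →ₜ* absoluteGaloisGroup F) σ = α.symm σ from rfl,
    cyclotomicCharacter_outerConj F (p := p) ĝ hα σ]

/-! ### §2 The intertwiner `V(τ)` between `V_pW|_{Γ_F} ∘ α⁻¹` and `V_pW|_{Γ_F}` -/

omit [CharZero K₀] [ValuativeRel F] [TopologicalSpace F] [IsNonarchimedeanLocalField F] [CharZero F]
  [Fact (¬ IsUnit (p : integerC F))] [IsAdicComplete (Ideal.span {(p : integerC F)}) (integerC F)] [Algebra ℚ_[p] F] in
include hconj hgτ in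
/-- **`V(τ)` intertwines**: `V(τ) ∘ V(res(α⁻¹ σ)) = V(res σ) ∘ V(τ)` on `V_pW`, i.e. `V(τ)` is an isomorphism from the representation
`V_pW|_{Γ_F} ∘ α⁻¹` to `V_pW|_{Γ_F}` (`res σ = τ · res(α⁻¹σ) · τ⁻¹`). [cite: SerreGaloisCohomology1997, I §2.4 (compatible pairs)] -/
theorem ratGalEquiv_intertwines_outer (σ : absoluteGaloisGroup F) (m : W.rationalTateModule p) :
    gτ (((restrictedRationalTateRep W F p).restrict (α.symm : absoluteGaloisGroup F →ₜ* absoluteGaloisGroup F)) σ m) =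
      restrictedRationalTateRep W F p σ (gτ m) := by
  rw [hgτ, hgτ, ContinuousRep.restrict_apply]
  change ((W.rationalTateGaloisRep p (W.continuous_rationalGaloisRepTate_holds p)) τ)
      (((W.rationalTateGaloisRep p (W.continuous_rationalGaloisRepTate_holds p))
        (absGaloisRestrict K₀ F ((α.symm : absoluteGaloisGroup F →ₜ* absoluteGaloisGroup F) σ))) m) =
    ((W.rationalTateGaloisRep p (W.continuous_rationalGaloisRepTate_holds p)) (absGaloisRestrict K₀ F σ))
      (((W.rationalTateGaloisRep p (W.continuous_rationalGaloisRepTate_holds p)) τ) m)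
  rw [hconj σ, map_mul, map_mul, Module.End.mul_apply, Module.End.mul_apply,
    ← Module.End.mul_apply ((W.rationalTateGaloisRep p (W.continuous_rationalGaloisRepTate_holds p)) τ⁻¹), ← map_mul,
    inv_mul_cancel, map_one, Module.End.one_apply]
  rfl

omit [CharZero K₀] in
include hconj hgτ in
/-- The Prop-1.2.3 injectivity binder passes from `V_pW|_{Γ_F}` to `V_pW|_{Γ_F} ∘ α⁻¹` (transport along `V(τ)⁻¹`).
[cite: Kato1993LNM1553, Ch. II Prop. 1.2.3 and §1.2.4] -/
theorem cupLogInjective_outerRestrict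
    (hinj : (bdRPeriodRingData (F := F) (p := p) hp).CupLogInjective (logCyclotomic p) (restrictedRationalTateRep W F p)) :
    (bdRPeriodRingData (F := F) (p := p) hp).CupLogInjective (logCyclotomic p)
      ((restrictedRationalTateRep W F p).restrict (α.symm : absoluteGaloisGroup F →ₜ* absoluteGaloisGroup F)) :=
  cupLogInjective_of_equiv gτ.symm (fun σ m => gτ.injective (by
    rw [LinearEquiv.apply_symm_apply, ratGalEquiv_intertwines_outer W F hconj hgτ, LinearEquiv.apply_symm_apply])) hinj

/-! ### §3 `exp*` is equivariant up to the transported generator -/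

omit [CharZero K₀] in
include hĝ hα hconj hgτ in
/-- ★ **`exp*_{ω''}(Conj η) = g (exp*_ω(η))` for a transported generator `ω''`.** Under the Prop-1.2.3 binders of `V_pW|_{Γ_F}`, for
every generator `d` of `D⁰_dR(V_pW|_{Γ_F})` there is a generator `d''` (namely `(1 ⊗ V(τ))(Φ_ĝ ⊗ 1) d.ω`, `Φ_ĝ` the filtered `g`-semilinear
automorphism of `B_dR(F)` over `α` of `BdROuterGalois`) such that for EVERY continuous crossed homomorphism `η : Γ_F → T_pW`:
`exp*_{d''}(σ ↦ τ • η(α⁻¹ σ)) = g(exp*_d(η))`. Kato's functoriality of `exp*` (II §1.2.4) along the automorphism `ĝ` of `(F̄ ⊃ F)`.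
[cite: Kato1993LNM1553, Ch. II §1.2.4 and Prop. 1.2.3] [cite: BrinonConrad2009, Prop. 6.3.8] -/
theorem exists_filZeroLine_expStarCoord_outerConj
    (hinj : (bdRPeriodRingData (F := F) (p := p) hp).CupLogInjective (logCyclotomic p) (restrictedRationalTateRep W F p))
    (hde : ∀ z : contOneCocycles (restrictedRationalTateRep W F p).toTopRep,
      (bdRPeriodRingData (F := F) (p := p) hp).HasDualExp (logCyclotomic p) (restrictedRationalTateRep W F p) fun σ => z.1 σ)
    (d : (bdRPeriodRingData (F := F) (p := p) hp).FilZeroLine (restrictedRationalTateRep W F p)) :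
    ∃ d'' : (bdRPeriodRingData (F := F) (p := p) hp).FilZeroLine (restrictedRationalTateRep W F p),
      ∀ η : contOneCocycles (restrictedTateRep W F p).toTopRep,
        expStarCoord W hp d''
            (contOneCocycles.pullback (α.symm : absoluteGaloisGroup F →ₜ* absoluteGaloisGroup F)
              ((W.tateGaloisRep p (W.continuous_galoisRepTate_holds p)).toIntRep.restrictConjHom
                ((absGaloisRestrict K₀ F).comp (α.symm : absoluteGaloisGroup F →ₜ* absoluteGaloisGroup F))
                (absGaloisRestrict K₀ F) τ hconj) η) =
          g (expStarCoord W hp d η) := by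
  have hFF : Surjective (fontaineTheta (integerC F) p) := surjective_fontaineTheta_integerC hp
  haveI := isDomain_bDeRhamPlus hFF
  obtain ⟨Φ, hΦs, -, -, hΦF, hΦfil⟩ := exists_fracBdR_ringEquiv_outer (ℓ := p) hp g ĝ hĝ hα hFF
  -- the abstract-transport data: `s = α⁻¹`, `Φr = Φ`, coefficient fields `F →[g] F`
  let s : absoluteGaloisGroup F →ₜ* absoluteGaloisGroup F := α.symm
  let ρ := restrictedRationalTateRep W F p
  let Φr : (bdRPeriodRingData hp).B →+* (bdRPeriodRingData hp).B := Φ.toRingHom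
  have hΦr : ∀ b, Φr b = Φ b := fun _ => rfl
  letI algFF : Algebra F F := (g : F →+* F).toAlgebra
  have hgp : ∀ q : ℚ_[p], g (algebraMap ℚ_[p] F q) = algebraMap ℚ_[p] F q := fun q =>
    RingHom.congr_fun (LocalField.ringHom_padic_ext ((g : F →+* F).comp (algebraMap ℚ_[p] F)) (algebraMap ℚ_[p] F)) q
  haveI : @IsScalarTower ℚ_[p] F F Algebra.toSMul algFF.toSMul Algebra.toSMul :=
    @IsScalarTower.of_algebraMap_eq ℚ_[p] F F _ _ _ _ algFF _ fun q => (hgp q).symm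
  have hΦE : ∀ e : F, Φr (algebraMap F (bdRPeriodRingData hp).B e) =
      algebraMap F (bdRPeriodRingData hp).B (algebraMap F F e) := fun e => by
    rw [hΦr]
    exact hΦF e
  have hΦs' : ∀ (σ : absoluteGaloisGroup F) (b : (bdRPeriodRingData hp).B), Φr (s σ • b) = σ • Φr b := fun σ b => by
    rw [hΦr, hΦr]
    have h := hΦs (s σ) b
    rw [show α (s σ) = σ from α.apply_symm_apply σ] at h
    exact h
  have hΦfil' : ∀ b, b ∈ (bdRPeriodRingData hp).fil 0 → Φr b ∈ (bdRPeriodRingData hp).fil 0 := fun b hb => by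
    rw [hΦr]
    exact (hΦfil 0 b).1 hb
  have hΦinj : Injective Φr := fun a b h => Φ.injective (by rwa [hΦr, hΦr] at h)
  have hψ : ∀ σ : absoluteGaloisGroup F, logCyclotomic p σ = logCyclotomic p (s σ) := logCyclotomic_outerConj F ĝ hα
  have hinj' := cupLogInjective_outerRestrict W F hp hconj hgτ hinj
  -- a generator of the line of `ρ ∘ α⁻¹` (transport `d` along `V(τ)⁻¹`), needed to know that the target `Fil⁰ D` is a line
  have hsymm : ∀ σ m, gτ.symm (ρ σ m) = (ρ.restrict s) σ (gτ.symm m) := fun σ m => gτ.injective (by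
    rw [LinearEquiv.apply_symm_apply, ratGalEquiv_intertwines_outer W F hconj hgτ, LinearEquiv.apply_symm_apply])
  let d₀' : (bdRPeriodRingData hp).FilZeroLine (ρ.restrict s) := d.map gτ.symm hsymm
  -- the transported generator of `Fil⁰ D(ρ ∘ α⁻¹)` and its push-forward along `V(τ)` to `Fil⁰ D(ρ)`
  let d' : (bdRPeriodRingData hp).FilZeroLine (ρ.restrict s) := filZeroLineTransport s ρ Φr hΦE hΦs' hΦfil' hΦinj d d₀'
  refine ⟨d'.map gτ (ratGalEquiv_intertwines_outer W F hconj hgτ), fun η => ?_⟩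
  -- the rational cocycle of `η` has a dual exponential
  have hz := hde ⟨⟨fun σ => TateModule.toRational p (η.1 σ),
      (by
        haveI := W.module_finite_tateModule_holds p
        exact (TateModule.continuous_toRational (A := geomPoints W) (p := p)).comp η.1.continuous)⟩,
    fun a b => by
      change TateModule.toRational p (η.1 (a * b)) = _
      rw [η.2 a b, map_add]
      rfl⟩
  -- abstract transport along `Φ_ĝ` over `α⁻¹`: `exp*_{(Φ⊗1)ω}(η ∘ α⁻¹) = g(exp*_ω η)` on `ρ ∘ α⁻¹`
  have h1 := dualExpCoord_filZeroLineTransport s ρ Φr hΦE hΦs' hΦfil' hΦinj d d₀' hψ hinj hinj' hz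
  -- transport along `V(τ)`: `exp*_{(1⊗V(τ))ω'}(V(τ) ∘ η ∘ α⁻¹) = exp*_{ω'}(η ∘ α⁻¹)`
  have hz' : (bdRPeriodRingData hp).HasDualExp (logCyclotomic p) (ρ.restrict s)
      (fun σ => TateModule.toRational p (η.1 (s σ))) :=
    hasDualExp_transport s ρ Φr hΦE hΦs' hΦfil' hψ hz
  have h2 := FilZeroLine.dualExpCoord_map d' gτ (ratGalEquiv_intertwines_outer W F hconj hgτ) hinj' hinj hz'
  unfold expStarCoord
  refine (Eq.trans (congrArg _ (funext fun σ => ?_)) h2).trans (h1.trans ?_)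
  · change TateModule.toRational p ((W.tateGaloisRep p (W.continuous_galoisRepTate_holds p)).toIntRep τ (η.1 (s σ))) =
      gτ (TateModule.toRational p (η.1 (s σ)))
    rw [hgτ]
    rfl
  · rfl

end Summit.BirchSwinnertonDyer.BirchSwinnertonDyer.Theorems.StarredOptimalManinUnitFiveSevenDualExpOuterGalois

end
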